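import Summits.Ventures.Crystal3D.Theorems.StickyWulffConstantCoaxialWallLawSeamPieceAssembly
import HarnessLib

/-!
# ONE CAP-CLOSED CORE PER PAYER: descent to any cap-closed superset of a piece, the UNION CORE, and `Σ_A(Y, z) ≤ capSummand cap (unionCore) z`
# (crux `CoaxialWallLaw`, stmt-Ventures-19481; line `WallLedgerF`, skeleton 'CoaxialWallLawCertificates' v8.1, stub `stub_incoherentSeamSmall`; F-TAIL-g12 §9)

HONEST FRAMING. Venture `Summits/Ventures/Crystal3D` (cell `crystal3d-full`); the single-core form of the multi-piece assembly.  `…SeamPieceAssembly` bounds `Σ_A` by the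
sum of the capped summands of the per-pair pieces; two pieces of the family that contain the same reader cluster (parent grain vs an inclined twin lamella, or
window-rim artefacts) would each count that cluster's pairs — a double count in the BOUND.  The remedy typed here: every pair descends to ANY cap-closed core
containing its piece, hence to the UNION CORE `unionCore` = capping closure of the union of the family; one core, each pair counted once, pools eroded by at most the
cap table (`JunkCapBoundClosed`).  Nothing about the stubs is claimed; the certificate for the union core is NOT here; F-C1 not moved.
* `isEndPairA_of_closed_superset_straight`, `isEndPairA_of_closed_superset_cross` — descent to a cap-closed `E ⊇` the reader's / target's piece;
* `unionCore Y z v S₁ S₂`, `isCapClosed_unionCore`, `pieceOf_subset_unionCore`, `isEndPairA_unionCore` (every (A)-pair ending within `1` of `z` is an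
  (A)-pair of the union core);
* **`localSummandA_le_coreTerm_unionCore`**, **`localSummandA_le_capSummand_unionCore`** — `Σ_A(Y, z) ≤ capSummand cap (unionCore) z` under `JunkCapBoundClosed cap`
  and positivity of the capped pools of the union core.
-/

noncomputable section

namespace Summit.Ventures.Crystal3D.Theorems

namespace TailResidue

open Summit.Ventures.Crystal3D Finset NearIdentity
open scoped InnerProductSpace

/-! ### Descent to any cap-closed superset of a piece -/

section Superset

variable {Y E : Finset (EuclideanSpace ℝ (Fin 3))} (hY : ∀ p ∈ Y, ∀ p' ∈ Y, p ≠ p' → 1 ≤ dist p p') {v : WordVersion} {S₁ S₂ : PlateSystem}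
  (h₁ : S₁.RT ⊆ fccSlots) (h₂ : S₂.RT ⊆ fccSlots) {z : EuclideanSpace ℝ (Fin 3)} (hD : IsCapClosed Y z E)
  {G : EuclideanSpace ℝ (Fin 3) ≃ₗᵢ[ℝ] EuclideanSpace ℝ (Fin 3)} {q b d : EuclideanSpace ℝ (Fin 3)}

include hY h₁ h₂ hD in
/-- **Straight moves descend to any cap-closed core containing the reader's piece.** -/
theorem isEndPairA_of_closed_superset_straight (hsub : pieceOf Y z q G ⊆ E) (hzb : dist z b ≤ 1) (hq : q ∈ Y) (hb : b ∈ Y) (hpay : HasTwoPayers Y b)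
    (hadm : S₁.Adm G d ∨ S₂.Adm G d) (hqd : q - d ∈ Y)
    (hrd : IsFull Y G q ∨ (v = WordVersion.v2 ∧ IsNarrow Y G d q) ∨ ∃ m, IsTwinReading Y G m q ∧ ⟪d, m⟫_ℝ = 0) (hbq : b = q + d) (hnm : ¬ IsMoving Y v G d b) :
    IsEndPairA E v S₁ S₂ b q := by
  classical
  have hEY : E ⊆ Y := hD.subset
  obtain ⟨⟨u, hu, hdu⟩, ⟨u', hu', hdu'⟩⟩ : (∃ u ∈ fccSlots, d = G u) ∧ (∃ u ∈ fccSlots, -d = G u) := by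
    rcases hadm with h | h
    · exact exists_slots_of_adm h₁ h
    · exact exists_slots_of_adm h₂ h
  have hdqb : dist q b = 1 := by rw [hbq, hdu]; exact dist_slotSite_eq_one G q hu
  have hzq : dist z q ≤ 2 := by linarith [dist_triangle z b q, dist_comm q b]
  have hq0 : G.symm (q - q) ∈ coaxialModule 1 (Real.sqrt (2 / 3)) := by rw [sub_self, map_zero]; exact ⟨0, 0, 0, 0, by simp⟩
  have hqE : q ∈ E := hsub (mem_pieceOf_base G hq (by linarith))
  have hsq : ∀ w ∈ fccSlots, q + G w ∈ Y → q + G w ∈ E := fun w hw hmem =>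
    hsub (mem_pieceOf_of_slot_at G hq0 hw hmem (by linarith [dist_triangle z q (q + G w), dist_slotSite_eq_one G q hw]))
  have hbE : b ∈ E := by rw [hbq, hdu] at hb ⊢; exact hsq u hu hb
  have hbmod : G.symm (b - q) ∈ coaxialModule 1 (Real.sqrt (2 / 3)) := by
    rw [hbq, hdu, add_sub_cancel_left, LinearIsometryEquiv.symm_apply_apply]; exact slot_mem_module hu
  have hsb : ∀ w ∈ fccSlots, b + G w ∈ Y → b + G w ∈ E := fun w hw hmem =>
    hsub (mem_pieceOf_of_slot_at G hbmod hw hmem (by linarith [dist_triangle z b (b + G w), dist_slotSite_eq_one G b hw]))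
  have hmq : ∀ m, IsTwinReading Y G m q → ∀ w ∈ fccSlots, q + (G w - (2 * ⟪G w, m⟫_ℝ) • m) ∈ Y → q + (G w - (2 * ⟪G w, m⟫_ℝ) • m) ∈ E :=
    fun m htw w hw hmem => reflect_slot_mem_of_capClosed hD hqE hzq htw.1 (fun u hu h0 => hsq u hu (htw.2.1 u hu h0.le)) hw hmem
  have hqdE : q - d ∈ E := by rw [sub_eq_add_neg, hdu'] at hqd ⊢; exact hsq u' hu' hqd
  exact ⟨hqE, hbE, hasTwoPayers_of_subset hY hEY hpay, G, d, hadm, hqdE, isEndMove_straight_of_sites hEY hrd hbq hnm hbE hsq hsb hmq⟩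

include hY h₁ h₂ hD in
/-- **Cross moves descend to any cap-closed core containing the target's twin piece.** -/
theorem isEndPairA_of_closed_superset_cross {m : EuclideanSpace ℝ (Fin 3)} (hsub : pieceOf Y z b (G.trans (ℝ ∙ m)ᗮ.reflection) ⊆ E) (hzb : dist z b ≤ 1)
    (hq : q ∈ Y) (hb : b ∈ Y) (hpay : HasTwoPayers Y b) (hadm : S₁.Adm G d ∨ S₂.Adm G d) (hqd : q - d ∈ Y) (htw : IsTwinReading Y G m q)
    (hdm : ⟪d, m⟫_ℝ = Real.sqrt (2 / 3)) (hbq : b = q - (d - (2 * ⟪d, m⟫_ℝ) • m)) (hnm : ¬ IsMoving Y v (G.trans (ℝ ∙ m)ᗮ.reflection) (b - q) b) :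
    IsEndPairA E v S₁ S₂ b q := by
  classical
  have hEY : E ⊆ Y := hD.subset
  set R := (ℝ ∙ m)ᗮ.reflection with hR
  set G' := G.trans R with hG'
  have hm1 : ‖m‖ = 1 := htw.1.1
  have hG'app : ∀ w, G' w = R (G w) := fun w => rfl
  have hRG' : ∀ w, R (G' w) = G w := fun w => by rw [hG'app, Submodule.reflection_reflection]
  have hRapp : ∀ x : EuclideanSpace ℝ (Fin 3), R x = x - (2 * ⟪x, m⟫_ℝ) • m := fun x => reflection_unit_apply hm1 x
  have hinn : ∀ w, ⟪G' w, m⟫_ℝ = -⟪G w, m⟫_ℝ := by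
    intro w
    rw [hG'app, hRapp, inner_sub_left, inner_smul_left, real_inner_self_eq_norm_sq, hm1]
    simp; ring
  have hn' : IsMenuNormal G' m := by
    refine ⟨hm1, fun w hw => ?_⟩
    rcases htw.1.2 w hw with h | h | h
    · exact Or.inl (by rw [hinn, h, neg_zero])
    · exact Or.inr (Or.inr (by rw [hinn, h]))
    · exact Or.inr (Or.inl (by rw [hinn, h, neg_neg]))
  obtain ⟨⟨u, hu, hdu⟩, ⟨u', hu', hdu'⟩⟩ : (∃ u ∈ fccSlots, d = G u) ∧ (∃ u ∈ fccSlots, -d = G u) := by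
    rcases hadm with h | h
    · exact exists_slots_of_adm h₁ h
    · exact exists_slots_of_adm h₂ h
  have hqb : q = b + G' u := by rw [hbq, hG'app, hRapp, ← hdu]; abel
  have hdbq : dist b q = 1 := by rw [hqb]; exact dist_slotSite_eq_one G' b hu
  have hzq : dist z q ≤ 2 := by linarith [dist_triangle z b q]
  have hb0 : G'.symm (b - b) ∈ coaxialModule 1 (Real.sqrt (2 / 3)) := by rw [sub_self, map_zero]; exact ⟨0, 0, 0, 0, by simp⟩
  have hqmod : G'.symm (q - b) ∈ coaxialModule 1 (Real.sqrt (2 / 3)) := by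
    rw [hqb, add_sub_cancel_left, LinearIsometryEquiv.symm_apply_apply]; exact slot_mem_module hu
  have hbE : b ∈ E := hsub (mem_pieceOf_base G' hb (by linarith))
  have hqE : q ∈ E := by rw [hqb] at hq ⊢; exact hsub (mem_pieceOf_of_slot_at G' hb0 hu hq (by rw [← hqb]; linarith))
  have hplane : ∀ w ∈ fccSlots, ⟪G' w, m⟫_ℝ = 0 → q + G' w ∈ E := by
    intro w hw h0
    have hG0 : ⟪G w, m⟫_ℝ = 0 := by rw [hinn] at h0; linarith
    have e : G' w = G w := by rw [hG'app]; exact Submodule.reflection_mem_subspace_eq_self (Submodule.mem_orthogonal_singleton_iff_inner_left.2 hG0)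
    have hmem : q + G w ∈ Y := htw.2.1 w hw hG0.le
    have hmem' : q + G' w ∈ Y := by rw [e]; exact hmem
    exact hsub (mem_pieceOf_of_slot_at G' hqmod hw hmem' (by linarith [dist_triangle z q (q + G' w), dist_slotSite_eq_one G' q hw]))
  have hsq : ∀ w ∈ fccSlots, q + G w ∈ Y → q + G w ∈ E := by
    intro w hw hmem
    have e : q + G w = q + (G' w - (2 * ⟪G' w, m⟫_ℝ) • m) := by rw [← hRapp, hRG']
    rw [e] at hmem ⊢
    exact reflect_slot_mem_of_capClosed hD hqE hzq hn' hplane hw hmem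
  have hmq : ∀ w ∈ fccSlots, q + (G w - (2 * ⟪G w, m⟫_ℝ) • m) ∈ Y → q + (G w - (2 * ⟪G w, m⟫_ℝ) • m) ∈ E := by
    intro w hw hmem
    have e : q + (G w - (2 * ⟪G w, m⟫_ℝ) • m) = q + G' w := by rw [← hRapp, ← hG'app]
    rw [e] at hmem ⊢
    exact hsub (mem_pieceOf_of_slot_at G' hqmod hw hmem (by linarith [dist_triangle z q (q + G' w), dist_slotSite_eq_one G' q hw]))
  have hsb' : ∀ w ∈ fccSlots, b + G' w ∈ Y → b + G' w ∈ E := fun w hw hmem =>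
    hsub (mem_pieceOf_of_slot_at G' hb0 hw hmem (by linarith [dist_triangle z b (b + G' w), dist_slotSite_eq_one G' b hw]))
  have hqdE : q - d ∈ E := by
    have e : q - d = q + G u' := by rw [sub_eq_add_neg, hdu']
    rw [e] at hqd ⊢
    exact hsq u' hu' hqd
  exact ⟨hqE, hbE, hasTwoPayers_of_subset hY hEY hpay, G, d, hadm, hqdE, isEndMove_cross_of_sites hEY htw hdm hbq hnm hsq hmq hsb'⟩

end Superset

/-! ### The union core -/

section Union

variable (Y : Finset (EuclideanSpace ℝ (Fin 3))) (z : EuclideanSpace ℝ (Fin 3)) (v : WordVersion) (S₁ S₂ : PlateSystem)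

open scoped Classical in
/-- **THE UNION CORE of the payer `z`**: the capping closure, in the payer window, of the union of ALL pieces `pieceOf Y z c S` that carry an (A)-end pair of `Y`
ending within `1` of `z` (as a pair of the piece). One cap-closed core to which every such pair descends. -/
def unionCore : Finset (EuclideanSpace ℝ (Fin 3)) :=
  capClosure (Y.filter fun x => dist z x ≤ 3)
    ((Y.filter fun x => dist z x ≤ 3).filter fun x =>
      ∃ c : EuclideanSpace ℝ (Fin 3), ∃ S : EuclideanSpace ℝ (Fin 3) ≃ₗᵢ[ℝ] EuclideanSpace ℝ (Fin 3), x ∈ pieceOf Y z c S ∧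
        ∃ b q : EuclideanSpace ℝ (Fin 3), dist z b ≤ 1 ∧ IsEndPairA Y v S₁ S₂ b q ∧ IsEndPairA (pieceOf Y z c S) v S₁ S₂ b q)

variable {Y z v S₁ S₂}

open scoped Classical in
/-- The union core is cap-closed in the payer window. -/
theorem isCapClosed_unionCore : IsCapClosed Y z (unionCore Y z v S₁ S₂) :=
  ⟨fun _ hx => mem_filter.1 (capClosure_subset (filter_subset _ _) hx),
    fun _ hx hzx hcap => mem_capClosure_of_capsTriangleIn (filter_subset _ _) (mem_filter.2 ⟨hx, hzx⟩) hcap⟩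

open scoped Classical in
/-- A piece carrying a pair near `z` lies in the union core. -/
theorem pieceOf_subset_unionCore {c : EuclideanSpace ℝ (Fin 3)} {S : EuclideanSpace ℝ (Fin 3) ≃ₗᵢ[ℝ] EuclideanSpace ℝ (Fin 3)} {b q : EuclideanSpace ℝ (Fin 3)}
    (hzb : dist z b ≤ 1) (hp : IsEndPairA Y v S₁ S₂ b q) (hpP : IsEndPairA (pieceOf Y z c S) v S₁ S₂ b q) : pieceOf Y z c S ⊆ unionCore Y z v S₁ S₂ :=
  fun _ hx => subset_capClosure _ (mem_filter.2 ⟨pieceOf_subset_window Y z c S hx, c, S, hx, b, q, hzb, hp, hpP⟩)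

open scoped Classical in
/-- **Every (A)-end pair ending within `1` of the payer is an (A)-end pair of the union core.** -/
theorem isEndPairA_unionCore (hY : ∀ p ∈ Y, ∀ p' ∈ Y, p ≠ p' → 1 ≤ dist p p') (h₁ : S₁.RT ⊆ fccSlots) (h₂ : S₂.RT ⊆ fccSlots) {b q : EuclideanSpace ℝ (Fin 3)}
    (hzb : dist z b ≤ 1) (hp : IsEndPairA Y v S₁ S₂ b q) : IsEndPairA (unionCore Y z v S₁ S₂) v S₁ S₂ b q := by
  have hD := isCapClosed_unionCore (Y := Y) (z := z) (v := v) (S₁ := S₁) (S₂ := S₂)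
  obtain ⟨hq, hb, hpay, G, d, hadm, hqd, hmove⟩ := id hp
  rcases hmove with ⟨hrd, hbq, hnm⟩ | ⟨m, htw, hdm, hbq, hnm⟩
  · have hpP := isEndPairA_pieceOf_of_straight hY h₁ h₂ hzb hq hb hpay hadm hqd hrd hbq hnm
    exact isEndPairA_of_closed_superset_straight hY h₁ h₂ hD (pieceOf_subset_unionCore hzb hp hpP) hzb hq hb hpay hadm hqd hrd hbq hnm
  · have hpP := isEndPairA_pieceOf_of_cross hY h₁ h₂ hzb hq hb hpay hadm hqd htw hdm hbq hnm
    exact isEndPairA_of_closed_superset_cross hY h₁ h₂ hD (pieceOf_subset_unionCore hzb hp hpP) hzb hq hb hpay hadm hqd htw hdm hbq hnm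

open scoped Classical in
/-- No residual for the singleton family `{unionCore}`. -/
theorem restPieceMultA_unionCore_eq_zero (hY : ∀ p ∈ Y, ∀ p' ∈ Y, p ≠ p' → 1 ≤ dist p p') (h₁ : S₁.RT ⊆ fccSlots) (h₂ : S₂.RT ⊆ fccSlots)
    {b : EuclideanSpace ℝ (Fin 3)} (hzb : dist z b ≤ 1) : restPieceMultA Y v S₁ S₂ {unionCore Y z v S₁ S₂} b = 0 := by
  unfold restPieceMultA
  rw [card_eq_zero, eq_empty_iff_forall_notMem]
  intro q hq
  obtain ⟨-, hp, hno⟩ := mem_filter.1 hq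
  exact hno _ (mem_singleton_self _) (isEndPairA_unionCore hY h₁ h₂ hzb hp)

open scoped Classical in
/-- **`Σ_A(Y, z) ≤ coreTerm Y (unionCore) z`** (lowered pools of the union core positive at its loaded balls within `1` of `z`). -/
theorem localSummandA_le_coreTerm_unionCore (hY : ∀ p ∈ Y, ∀ p' ∈ Y, p ≠ p' → 1 ≤ dist p p') (h₁ : S₁.RT ⊆ fccSlots) (h₂ : S₂.RT ⊆ fccSlots)
    (hpos : ∀ b ∈ unionCore Y z v S₁ S₂, dist z b ≤ 1 → 0 < endMultA (unionCore Y z v S₁ S₂) v S₁ S₂ b → 0 < loweredPool Y (unionCore Y z v S₁ S₂) b) :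
    localSummandA v S₁ S₂ Y z ≤ coreTerm Y (unionCore Y z v S₁ S₂) v S₁ S₂ z := by
  have h := localSummandA_le_sum_coreTerms_add_restPiece (v := v) (S₁ := S₁) (S₂ := S₂) hY z {unionCore Y z v S₁ S₂}
    (fun E hE => by rw [mem_singleton.1 hE]; exact hD_sub) (fun E hE => by rw [mem_singleton.1 hE]; exact hpos)
  · have hzero : ∑ b ∈ Y.filter (fun b => dist z b ≤ 1 ∧ 0 < restPieceMultA Y v S₁ S₂ {unionCore Y z v S₁ S₂} b),
        (restPieceMultA Y v S₁ S₂ {unionCore Y z v S₁ S₂} b : ℝ) / pooledDef Y b = 0 := by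
      refine sum_eq_zero fun b hb => ?_
      obtain ⟨-, hzb, hr⟩ := mem_filter.1 hb
      rw [restPieceMultA_unionCore_eq_zero hY h₁ h₂ hzb] at hr
      exact absurd hr (lt_irrefl 0)
    rw [sum_singleton] at h
    linarith
  where hD_sub : unionCore Y z v S₁ S₂ ⊆ Y := (isCapClosed_unionCore (Y := Y) (z := z) (v := v) (S₁ := S₁) (S₂ := S₂)).subset

open scoped Classical in
/-- **`Σ_A(Y, z) ≤ capSummand cap (unionCore) z`** under `JunkCapBoundClosed cap` and positivity of the capped pools of the union core — ONE cap-closed core per payer,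
every pair counted once, pools eroded by at most the cap table. What remains is a certificate for the union core (a closure of mutually compatible or foreign exact
clusters around one payer). -/
theorem localSummandA_le_capSummand_unionCore (cap : Finset (EuclideanSpace ℝ (Fin 3)) → EuclideanSpace ℝ (Fin 3) → ℕ)
    (hY : ∀ p ∈ Y, ∀ p' ∈ Y, p ≠ p' → 1 ≤ dist p p') (h₁ : S₁.RT ⊆ fccSlots) (h₂ : S₂.RT ⊆ fccSlots) (hcap : JunkCapBoundClosed cap)
    (hpos : ∀ b ∈ unionCore Y z v S₁ S₂, dist z b ≤ 1 → 0 < endMultA (unionCore Y z v S₁ S₂) v S₁ S₂ b → 0 < capPool cap (unionCore Y z v S₁ S₂) b) :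
    localSummandA v S₁ S₂ Y z ≤ capSummand cap v S₁ S₂ (unionCore Y z v S₁ S₂) z := by
  have hD := isCapClosed_unionCore (Y := Y) (z := z) (v := v) (S₁ := S₁) (S₂ := S₂)
  have hpos' : ∀ b ∈ unionCore Y z v S₁ S₂, dist z b ≤ 1 → 0 < endMultA (unionCore Y z v S₁ S₂) v S₁ S₂ b → 0 < loweredPool Y (unionCore Y z v S₁ S₂) b :=
    fun b hb hzb he => lt_of_lt_of_le (hpos b hb hzb he) (capPool_le_loweredPool_of_closed cap hY hD hcap hzb)
  exact (localSummandA_le_coreTerm_unionCore hY h₁ h₂ hpos').trans (coreTerm_le_capSummand_of_closed cap hY hD hcap v S₁ S₂ hpos)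

end Union



end TailResidue

end Summit.Ventures.Crystal3D.Theorems

end
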